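import Summits.QuantumFields.YangMills.Theorems.UV3ACLargeFieldEnvelopeRows
import Summits.QuantumFields.YangMills.Theorems.UV3ACBounds5UpperRows
import Summits.QuantumFields.YangMills.Theorems.UnitScaleTiltHistoryTailIntPintRows
import HarnessLib

/-!
# `UV3ACBounds5UpperOfRows` — R3 (cell `ym3-torus`, YM₃ on T³ — a ladder RUNG, NOT d = 4, NOT infinite volume, NOT a mass gap, NOT the Clay problem):
# **[Balaban1985UV3] THEOREM 1 (5), UPPER HALF, HEIGHTWISE — lit `Bounds5UpperAtHeight` — FROM A ROWS RECORD ALONE** (the version-agnostic `AlphaInputsT3AC.PkgCoreRows`,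
# ★★OWNER RULING g26-№14 (F-2b)), hence from the v4 χ-socket `AlphaInputsT3AC.OfV4ChiAt` that the 19936 registry's stubs {EX, (O‴χₛ)} deliver, and again from the v3 socket

Width seat `ym3-torus-px8` g15 ((C) census `CENSUS-V3-SOCKET-ROWS-px8g15.md` = 19936 evidence #42).  THEOREMS ONLY (0 `def`, 0 `sorry`, default heartbeats);
`--supports stmt-QuantumFields-20520 --as helper`; count-neutral.  CONDITIONAL on a family of rows records `q : ∀ K, AlphaInputsT3AC.PkgCoreRows F 𝔠 γ hγ hγ1 K` (OPEN: fed
by the v3 socket through ✓`PkgAtV3.toCore`∕✓`PkgCoreV3.toRows` or by the v4 χ-socket through ✓`PkgAtV4Chi.toRows`); nothing of [Balaban1985UV3] is asserted.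

WHY.  The v3 edition ✓`UV3ACBounds5UpperRows.bounds5UpperAtHeight_of_v3` (px8 g15, p768108; ★★OWNER g35: edition of record of `Bounds5UpperAtHeight`) is conditional on the v3
socket `OfV3At`, two rows of which (L-67 `hLF67`, A-2 `fibre57Low`) have no supplier of record (RULINGS g26-№14 ∕ g23-№2); the chain of record feeds the rows record.  THIS FILE
is that edition VERBATIM over `PkgCoreRows` — every row call exists there by name: (41)′ ✓`PkgCoreRows.resDensity_le_sum_ae`, the remainder ✓`PkgCoreRows.Rm_eq`, (46)
✓`PkgCoreRows.abs_Pint_succ_le` (w6 g2, `UnitScaleTiltHistoryTailIntPintRows`), the core step rows `(p.runRows.steps j hj).logZT ∕ .chart` (`AlphaV3AC.StepAlphaV3CoreAC`), and the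
(41)_k large-field sum ✓`UV3ACLargeFieldEnvelopeRows.exists_lfSum_le_exp_ae_rows` (this seat, rows edition; small factors from the (71)-row).
* §1 `sites_level_eq_rows`, `Rm_height_le_rows` — `Rm_{K−n} ≤ (r⋆∕(1 − L^{−κ₀}))·N_n³`.
* §2 `abs_Pint_le_level_rows` ∕ `abs_Pint_le_height_rows` — (46): `|Pint_{K−n}(r, W)| ≤ (C46·M₁³)·θBal(n+1)²·N_n³`.
* §3 `bound25_vac_of_alphaV3Core`, `abs_Estep_le_rows`, `abs_Ecst_le_height_rows` — (25) at the chart centre, (62) per step, (64)–(65) at height `n`.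
* §4 ★★★ `bounds5UpperAtHeight_of_rows_displayed` (the three per-height rows displayed, twin of ✓`bounds5UpperAtHeight_of_v3_rows`) and ★★★★ `bounds5UpperAtHeight_of_rows
  (q : ∀ K, AlphaInputsT3AC.PkgCoreRows F 𝔠 γ hγ hγ1 K) : Bounds5UpperAtHeight F γ (fun K => (q K).E)` — NO other hypothesis.
* §5 the socket reading: ★★★★ `bounds5UpperAtHeight_of_v4Chi (h : AlphaInputsT3AC.OfV4ChiAt F 𝔠 a₀ a₁)` (the v4 χ-socket = the currency the suppliers of record deliver:
  ✓`laneRecordsV4Chi_of_thm1In8_selXsDataRows_allL`); the v3 edition's statement is §4 at `(h.pkgAtV3 …).toCore.toRows`, letter for letter (remark in §5, not re-declared).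
HONEST SCOPE.  Bookkeeping over landed theorems; conditional on the rows record ∕ the sockets (all OPEN); ⟨UP⟩ = `HeightwiseUpperBound` still needs (6)∕a lower letter (lit
✓`heightwiseUpperBound_of_bounds5`; the LEAD's quotient road); nothing of (5)∕(41)∕(47), PERS₁∘, 20520, 19936, the rung, d = 4, a mass gap or Clay is proved here; the
Yang–Mills mass gap is NOT proved.

References: T. Bałaban, Commun. Math. Phys. **102** (1985) 255–275 [Balaban1985UV3] ((5) p.256, Thm 1 p.257, (25) p.262, (41) p.266, (46) p.267, (62) p.271, (64)–(65)
p.273, (67)–(71) p.273, Sect. D pp.272–274); Commun. Math. Phys. **102** (1985) 277–309 [Balaban1985Variational] (Thm 1 (8) p.279).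
-/

set_option autoImplicit false

noncomputable section

namespace Summit.QuantumFields.YangMills.Theorems.UV3ACBounds5UpperOfRows

open MeasureTheory
open scoped BigOperators
open Literature.MathematicalPhysics.QuantumFieldTheory.Balaban1983to89
open Literature.MathematicalPhysics.QuantumFieldTheory.Balaban1983to89.T3ContinuumYM3Torus
open Literature.MathematicalPhysics.QuantumFieldTheory.Balaban1983to89.T3LevelShift (fieldShift measurePreserving_fieldShift)
open Literature.MathematicalPhysics.QuantumFieldTheory.Balaban1983to89.T3UnitLawDensityEML (ℰp)
open Literature.MathematicalPhysics.QuantumFieldTheory.Balaban1983to89.T3RestrictedUnitDensity (resDensity)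
open Literature.MathematicalPhysics.QuantumFieldTheory.Balaban1983to89.T3TiltDescent (heightDensity)
open Literature.MathematicalPhysics.QuantumFieldTheory.Balaban1983to89.T3UnitScaleTilt (θBal)
open Literature.MathematicalPhysics.QuantumFieldTheory.Balaban1983to89.T3HeightwiseDensityBounds (Bounds5UpperAtHeight)
open Literature.MathematicalPhysics.QuantumFieldTheory.Balaban1983to89.TreeLengthTorus (tsys)
open Literature.MathematicalPhysics.QuantumFieldTheory.Balaban1985CMP102
open Literature.MathematicalPhysics.QuantumFieldTheory.Balaban1985CMP102.Setting
open Summit.QuantumFields.Balaban3D.Carriers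
open Summit.QuantumFields.Balaban3D.Proofs.Primitives
open Summit.QuantumFields.Balaban3D.Proofs.ScalesArithmetic (gk_pos gk_le_one g0sq_pos gk_eq_gRun_norm sites_eq_sitesRun_norm normVol_nonneg
  starCount_univ_nonneg starCount_univ_le_three_sites sites_eq_sitesPerDir_pow sites_nonneg)
open Summit.QuantumFields.Balaban3D.Proofs.GroupModelLieC (lieC)
open Summit.QuantumFields.Balaban3D.Proofs.TowerAC
open Summit.QuantumFields.Balaban3D.Proofs.StandardAC
open Summit.QuantumFields.Balaban3D.Proofs.InputsAC
open Summit.QuantumFields.Balaban3D.Proofs.AlphaAC (AlphaDataAC)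
open Summit.QuantumFields.Balaban3D.Proofs.AlphaAdaptersAC (logZT_le_piecesAC pprT_le_piecesAC)
open Summit.QuantumFields.YangMills.Theorems.AlphaV3AC
open Summit.QuantumFields.YangMills.Theorems.UV3ACBounds5Upper (card_site_level_eq card_pBond_level_eq sum_weight_pint_le)
open Summit.QuantumFields.YangMills.Theorems.UV3ACLargeFieldEnvelopeRows (exists_lfSum_le_exp_ae_rows)

variable {F : T3Family} {𝔠 : AlphaConsts F.L (suGroupModel 2).N} {γ : ℝ} {hγ : 0 < γ} {hγ1 : γ ≤ (min 𝔠.gamma0 1) ^ 2} {K : ℕ}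

/-- The height-`n` site count is the level-`(K−n)` site count of run `K` (K-FREE): `|T₁^{(K−n)}| = N_n³`, for a rows record's tower. [cite: Balaban1985UV3, p.256] -/
theorem sites_level_eq_rows (p : AlphaInputsT3AC.PkgCoreRows F 𝔠 γ hγ hγ1 K) {n : ℕ} (_hK : n ≤ K) :
    p.T.sites (K - n) = ((F.P n).sitesPerDir 0 : ℝ) ^ 3 := by
  show (T3Scales F γ hγ (hγ1.trans (sq_min_one_le _ 𝔠.gamma0_pos)) K).sites (K - n) = _
  rw [sites_eq_sitesPerDir_pow _ (K - n) (by show K - n ≤ F.m + K; omega)]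
  have hs : (F.P K).sitesPerDir (K - n) = (F.P n).sitesPerDir 0 :=
    (F.sitesPerDir_eq (m := F.m) (K := n) (j := 0) (m' := F.m) (K' := K) (j' := K - n) (by omega)).symm
  show (((F.P K).sitesPerDir (K - n) : ℕ) : ℝ) ^ 3 = _
  rw [hs]

/-! ## §1 The remainder row -/

/-- **THE REMAINDER OF (41) AT HEIGHT `n` IS `O(1)·N_n³`, K-FREE** (rows twin of ✓`UV3ACBounds5UpperRows.Rm_height_le_v3`): `Rm_{K−n} ≤ (r⋆∕(1 − L^{−κ₀}))·N_n³` —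
✓`PkgCoreRows.Rm_eq`, `q^{K−i} ≤ q^{j−i}`, lit ✓`geomTail_le`, `γ^{3+κ₀} ≤ 1`, `(2L^m)³ ≤ N_n³`. [cite: Balaban1985UV3, (41) p.266] -/
theorem Rm_height_le_rows (p : AlphaInputsT3AC.PkgCoreRows F 𝔠 γ hγ hγ1 K) (n : ℕ) :
    p.T.Rm (K - n) ≤ 𝔠.stepConsts.rstar / (1 - ((F.L : ℝ)⁻¹) ^ 𝔠.κ₀) * ((F.P n).sitesPerDir 0 : ℝ) ^ 3 := by
  have hL1 : (1 : ℝ) < F.L := by exact_mod_cast F.hL.2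
  have hL0 : (0 : ℝ) < F.L := by linarith
  have hγ1' : γ ≤ 1 := hγ1.trans (sq_min_one_le _ 𝔠.gamma0_pos)
  set q : ℝ := ((F.L : ℝ)⁻¹) ^ 𝔠.κ₀ with hq
  have hq0 : 0 ≤ q := Real.rpow_nonneg (inv_nonneg.mpr hL0.le) _
  have hq1 : q < 1 := Real.rpow_lt_one (inv_nonneg.mpr hL0.le) (inv_lt_one_of_one_lt₀ hL1) 𝔠.κ₀_pos
  have hr : 0 ≤ 𝔠.stepConsts.rstar := 𝔠.stepConsts.rstar_nonneg
  rw [p.Rm_eq (K - n) (Nat.sub_le K n)]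
  -- the geometric factor
  have hgeo : ∑ i ∈ Finset.range (K - n), q ^ (K - i) ≤ 1 / (1 - q) := by
    have h1 : ∑ i ∈ Finset.range (K - n), q ^ (K - i) ≤ ∑ i ∈ Finset.range (K - n), q ^ (K - n - i) :=
      Finset.sum_le_sum fun i hi => by
        rw [Finset.mem_range] at hi
        exact pow_le_pow_of_le_one hq0 hq1.le (by omega)
    refine h1.trans ((B10LargeFieldSum.geomTail_le hq0 hq1 (K - n)).trans ?_)
    exact div_le_div_of_nonneg_right (hq1.le) (by linarith)
  -- `γ^{3+κ₀} ≤ 1`, `(2L^m)³ ≤ N_n³`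
  have hγp : γ ^ (3 + 𝔠.κ₀) ≤ 1 := Real.rpow_le_one hγ.le hγ1' (by linarith [𝔠.κ₀_pos])
  have hγp0 : 0 ≤ γ ^ (3 + 𝔠.κ₀) := Real.rpow_nonneg hγ.le _
  have hN : (2 * (F.L : ℝ) ^ F.m) ^ 3 ≤ ((F.P n).sitesPerDir 0 : ℝ) ^ 3 := by
    have h1 : ((F.P n).sitesPerDir 0 : ℝ) = 2 * (F.L : ℝ) ^ (F.m + n) := by
      rw [show (F.P n).sitesPerDir 0 = 2 * F.L ^ (F.m + n) by simp [Params.sitesPerDir]]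
      push_cast; ring
    rw [h1, pow_add]
    have h2 : (1 : ℝ) ≤ (F.L : ℝ) ^ n := one_le_pow₀ hL1.le
    have h3 : (0 : ℝ) ≤ 2 * (F.L : ℝ) ^ F.m := by positivity
    exact pow_le_pow_left₀ h3 (by nlinarith) 3
  have hN0 : (0 : ℝ) ≤ (2 * (F.L : ℝ) ^ F.m) ^ 3 := by positivity
  have hgeo0 : 0 ≤ ∑ i ∈ Finset.range (K - n), q ^ (K - i) := Finset.sum_nonneg fun i _ => pow_nonneg hq0 _
  have h1q : 0 < 1 - q := by linarith
  calc 𝔠.stepConsts.rstar * γ ^ (3 + 𝔠.κ₀) * (∑ i ∈ Finset.range (K - n), q ^ (K - i)) * (2 * (F.L : ℝ) ^ F.m) ^ 3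
      ≤ 𝔠.stepConsts.rstar * 1 * (1 / (1 - q)) * ((F.P n).sitesPerDir 0 : ℝ) ^ 3 := by
        gcongr
    _ = 𝔠.stepConsts.rstar / (1 - q) * ((F.P n).sitesPerDir 0 : ℝ) ^ 3 := by ring

/-! ## §2 The interaction row (46) -/

/-- **(46) AT EVERY LEVEL for a rows record**: `|Pint_j(r, W)| ≤ (C46·M₁³)·θBal(K − j + 1)²·((F.P K).sitesPerDir j)³` for `j ≤ K` — at `j = 0` there is no interaction
(`noInteraction0_towerOfAC`), at `j = k + 1` ✓`PkgCoreRows.abs_Pint_succ_le` with `#Ω_{k+1}^{(k+1)}(r) ≤ #T^{(k+1)}` (✓`card_lamFin_le_sitesPerDir_cube`). [cite: Balaban1985UV3, (46) p.267] -/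
theorem abs_Pint_le_level_rows (p : AlphaInputsT3AC.PkgCoreRows F 𝔠 γ hγ hγ1 K) (j : ℕ) (hj : j ≤ K) (r : Hist (F.P K) j)
    (W : GaugeField (F.P K) j (Matrix.specialUnitaryGroup (Fin 2) ℂ)) :
    |p.T.Pint j r W| ≤ (𝔠.C46 * (𝔠.M₁ : ℝ) ^ 3) * θBal F.L γ 𝔠.b₀ 𝔠.p₀ (K - j + 1) ^ 2 * ((F.P K).sitesPerDir j : ℝ) ^ 3 := by
  cases j with
  | zero =>
    have h0 : p.T.Pint 0 r W = 0 := noInteraction0_towerOfAC 𝔠.lane p.X p.𝔖 r W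
    rw [h0, abs_zero]
    have hC : 0 ≤ 𝔠.C46 * (𝔠.M₁ : ℝ) ^ 3 := mul_nonneg 𝔠.C46_nonneg (by positivity)
    positivity
  | succ k =>
    have h1 := p.abs_Pint_succ_le k hj r W
    have h2 := card_lamFin_le_sitesPerDir_cube (F := F) (K := K) 𝔠.lane.carrier.M₁
      (rcolOf (T3Scales F γ hγ (hγ1.trans (sq_min_one_le _ 𝔠.gamma0_pos)) K) 𝔠.lane.carrier) k r
    have hC : 0 ≤ (𝔠.C46 * (𝔠.M₁ : ℝ) ^ 3) * θBal F.L γ 𝔠.b₀ 𝔠.p₀ (K - k) ^ 2 :=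
      mul_nonneg (mul_nonneg 𝔠.C46_nonneg (by positivity)) (sq_nonneg _)
    rw [show K - (k + 1) + 1 = K - k by omega]
    exact h1.trans (mul_le_mul_of_nonneg_left h2 hC)

/-- **(46) AT HEIGHT `n`, K-FREE, for a rows record**: `|Pint_{K−n}(r, W)| ≤ (C46·M₁³)·θBal(n+1)²·N_n³` for every `K ≥ n`, history and field. [cite: Balaban1985UV3, (46) p.267] -/
theorem abs_Pint_le_height_rows (p : AlphaInputsT3AC.PkgCoreRows F 𝔠 γ hγ hγ1 K) {n : ℕ} (hK : n ≤ K) (r : Hist (F.P K) (K - n))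
    (W : GaugeField (F.P K) (K - n) (Matrix.specialUnitaryGroup (Fin 2) ℂ)) :
    |p.T.Pint (K - n) r W| ≤ (𝔠.C46 * (𝔠.M₁ : ℝ) ^ 3) * θBal F.L γ 𝔠.b₀ 𝔠.p₀ (n + 1) ^ 2 * ((F.P n).sitesPerDir 0 : ℝ) ^ 3 := by
  have h := abs_Pint_le_level_rows p (K - n) (Nat.sub_le K n) r W
  have hs : (F.P K).sitesPerDir (K - n) = (F.P n).sitesPerDir 0 :=
    (F.sitesPerDir_eq (m := F.m) (K := n) (j := 0) (m' := F.m) (K' := K) (j' := K - n) (by omega)).symm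
  rw [show K - (K - n) + 1 = n + 1 by omega, hs] at h
  exact h

/-! ## §3 The counterterm row (62)–(65) -/

/-- **(25) AT THE CHART CENTRE from the CORE step rows** (the vacuum activities `Re Ψ_X(0)` of (62); G3D-01's bound at `B = 0` — ✓`bound25_vac_of_alphaV3` VERBATIM for
`StepAlphaV3CoreAC`, so it serves every socket version). [cite: Balaban1985UV3, (25) p.262] -/
theorem bound25_vac_of_alphaV3Core {L : ℕ} {S : Scales L} {G : Type} [GaugeGroup G] [MeasurableSpace G] [HaarData G] {𝔊 : GroupModel G}
    {𝔠 : AlphaConsts L 𝔊.N} {X : ExternalInputsAC S G} {𝔖 : ∀ k, StepSeries S G ↥(lieC 𝔊) (nblkOf S 𝔠.lane.carrier k) k}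
    {𝔄 : AlphaDataAC 𝔊 𝔠 X 𝔖} {win : (k : ℕ) → Hist S.P (k + 1) → Set (GaugeField S.P (k + 1) G)}
    (k : ℕ) (A : StepAlphaV3CoreAC 𝔊 𝔠 X 𝔖 𝔄 win k) :
    B10.Bound25Printed ⟨(tsys 3 (nblkOf S 𝔠.lane.carrier k)).Dom, GaugeField S.P (k + 1) G, (tsys 3 (nblkOf S 𝔠.lane.carrier k)).dj,
      fun Y _ => ((𝔖 k).Ψ Y 0).re⟩ (S.gk k) 𝔠.κ 𝔠.C25 := by
  intro Y _
  have hρ : 0 < 𝔠.ρ := (A.chart Y).1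
  exact (Complex.abs_re_le_norm _).trans ((A.chart Y).2.2 0 (Metric.mem_closedBall_self (by positivity)))

/-- **(62) PER STEP for a rows record's tower**: `|E^{(j)}| ≤ (a₁ + 3dg·|log g_j|)·|T₁^{(j)}|` for `j < K`, `a₁ := 3|log σ₀| + z + aP` — the `rfl` leaf `Estep62` of the AC series,
the star count (✓`starCount_univ_nonneg`∕`…_le_three_sites`), G3D-05 at the core row `logZT` (✓`logZT_le_piecesAC`), (25) at the chart centre (✓`pprT_le_piecesAC`), lit
✓`B10.Estep62_abs_le`. [cite: Balaban1985UV3, (62) p.271 + (65) p.273] -/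
theorem abs_Estep_le_rows (p : AlphaInputsT3AC.PkgCoreRows F 𝔠 γ hγ hγ1 K) (j : ℕ) (hj : j < K) :
    |p.T.Estep j| ≤ ((3 * |𝔠.lane.carrier.logσ₀| + 𝔠.lane.F.z + 𝔠.lane.F.aP) + (3 * 𝔠.lane.carrier.dg) * |Real.log (p.T.g j)|) * p.T.sites j := by
  set S := T3Scales F γ hγ (hγ1.trans (sq_min_one_le _ 𝔠.gamma0_pos)) K with hS
  have hj' : j + 1 ≤ K := hj
  have hE : p.T.Estep j = ((piecesAC 𝔠.lane p.X p.𝔖 j).logσ₀ + (piecesAC 𝔠.lane p.X p.𝔖 j).dg * Real.log (p.T.g j))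
      * (piecesAC 𝔠.lane p.X p.𝔖 j).starT + (piecesAC 𝔠.lane p.X p.𝔖 j).logZT + (piecesAC 𝔠.lane p.X p.𝔖 j).PprT :=
    (p.X.toTowerBase 𝔠.lane.carrier).estep62_seriesAC _ _ j
  have hstarT : (piecesAC 𝔠.lane p.X p.𝔖 j).starT = (B10StarCount.starCount (Finset.univ : Finset (Site S.P (j + 1))) : ℝ) := rfl
  have hσ : (piecesAC 𝔠.lane p.X p.𝔖 j).logσ₀ = 𝔠.lane.carrier.logσ₀ := rfl
  have hdg : (piecesAC 𝔠.lane p.X p.𝔖 j).dg = 𝔠.lane.carrier.dg := rfl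
  have hsites : p.T.sites j = S.sites j := rfl
  have hZ := logZT_le_piecesAC 𝔠.lane p.X p.𝔖 j 𝔠.cT_pos rfl (p.runRows.steps j hj').logZT
  have hP := pprT_le_piecesAC 𝔠.lane p.X p.𝔖 j hj' (by linarith [𝔠.kappa_ge]) 𝔠.C25_nonneg rfl
    (bound25_vac_of_alphaV3Core j (p.runRows.steps j hj'))
  have h62 := B10.Estep62_abs_le (piecesAC 𝔠.lane p.X p.𝔖 j).logσ₀ (piecesAC 𝔠.lane p.X p.𝔖 j).dg (Real.log (p.T.g j))
    (piecesAC 𝔠.lane p.X p.𝔖 j).logZT (piecesAC 𝔠.lane p.X p.𝔖 j).PprT (piecesAC 𝔠.lane p.X p.𝔖 j).starT (S.sites j) 𝔠.lane.F.aP 𝔠.lane.F.z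
    (piecesAC 𝔠.lane p.X p.𝔖 j).dg_nonneg
    (by rw [hstarT]; exact starCount_univ_nonneg S j (by show j + 1 ≤ F.m + K; omega))
    (by rw [hstarT]; exact starCount_univ_le_three_sites S j (by show j + 1 ≤ F.m + K; omega)) hZ hP
  have hrw : p.T.Estep j = (piecesAC 𝔠.lane p.X p.𝔖 j).logσ₀ * (piecesAC 𝔠.lane p.X p.𝔖 j).starT
      + (piecesAC 𝔠.lane p.X p.𝔖 j).dg * Real.log (p.T.g j) * (piecesAC 𝔠.lane p.X p.𝔖 j).starT
      + (piecesAC 𝔠.lane p.X p.𝔖 j).logZT + (piecesAC 𝔠.lane p.X p.𝔖 j).PprT := by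
    rw [hE]; ring
  rw [hrw, hsites]
  refine h62.trans (mul_le_mul_of_nonneg_right (le_of_eq ?_) (sites_nonneg S j))
  rw [hσ, hdg]

/-- **(64)–(65) AT HEIGHT `n`, K-FREE, for a rows record**: `|E_{K−n}| ≤ b_n·N_n³` with
`b_n := (a₁ + 3dg·|log g_n|)∕(1 − L⁻³) + 3dg·(½log L)·L⁻³∕(1 − L⁻³)²`, `g_n = √(γL^{−n})`, `a₁ = 3|log σ₀| + z + aP` (lit ✓`B10.Ecst_abs_le_window` over §3's per-step bound).
[cite: Balaban1985UV3, (64)–(65) p.273] -/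
theorem abs_Ecst_le_height_rows (p : AlphaInputsT3AC.PkgCoreRows F 𝔠 γ hγ hγ1 K) {n : ℕ} (hK : n ≤ K) :
    |p.T.Ecst (K - n)| ≤
      (((3 * |𝔠.lane.carrier.logσ₀| + 𝔠.lane.F.z + 𝔠.lane.F.aP) + (3 * 𝔠.lane.carrier.dg) *
          max |Real.log (Real.sqrt (γ * ((F.L : ℝ)⁻¹) ^ n))| |Real.log (Real.sqrt (γ * ((F.L : ℝ)⁻¹) ^ n))|) / (1 - ((F.L : ℝ) ^ 3)⁻¹)
        + ((3 * 𝔠.lane.carrier.dg) * (Real.log F.L / 2)) * (((F.L : ℝ) ^ 3)⁻¹ / (1 - ((F.L : ℝ) ^ 3)⁻¹) ^ 2)) *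
        ((F.P n).sitesPerDir 0 : ℝ) ^ 3 := by
  set S := T3Scales F γ hγ (hγ1.trans (sq_min_one_le _ 𝔠.gamma0_pos)) K with hS
  have hL1 : (1 : ℝ) < F.L := by exact_mod_cast F.hL.2
  have hgn : p.T.g (K - n) = Real.sqrt (γ * ((F.L : ℝ)⁻¹) ^ n) := by
    have h := T3Scales_gk_eq F γ hγ (hγ1.trans (sq_min_one_le _ 𝔠.gamma0_pos)) K (K - n) (Nat.sub_le K n)
    rw [show K - (K - n) = n by omega] at h
    exact h
  have hgpos : 0 < Real.sqrt (γ * ((F.L : ℝ)⁻¹) ^ n) := by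
    rw [← hgn]; exact gk_pos S (K - n)
  have hdg : 0 ≤ 3 * 𝔠.lane.carrier.dg := by linarith [𝔠.lane.carrier.dg_nonneg]
  have ha₁ : 0 ≤ 3 * |𝔠.lane.carrier.logσ₀| + 𝔠.lane.F.z + 𝔠.lane.F.aP := by
    have h0 := abs_nonneg 𝔠.lane.carrier.logσ₀
    have hz : 0 ≤ 𝔠.lane.F.z := 𝔠.z_nonneg
    have ha : 0 ≤ 𝔠.lane.F.aP := 𝔠.aP_nonneg
    linarith
  have h := B10.Ecst_abs_le_window p.T 1 (F.L : ℝ) S.g0sq (S.g ^ 6 * S.volT)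
    (3 * |𝔠.lane.carrier.logσ₀| + 𝔠.lane.F.z + 𝔠.lane.F.aP) (3 * 𝔠.lane.carrier.dg) one_pos hL1 (g0sq_pos S) (normVol_nonneg S) ha₁ hdg
    (fun k => gk_eq_gRun_norm S k) (fun k => sites_eq_sitesRun_norm S k) (fun j hj => abs_Estep_le_rows p j hj)
    (Real.sqrt (γ * ((F.L : ℝ)⁻¹) ^ n)) (Real.sqrt (γ * ((F.L : ℝ)⁻¹) ^ n)) hgpos (K - n) hgn.symm.le hgn.le
  rw [sites_level_eq_rows p hK] at h
  exact h

/-! ## §4 Theorem 1 (5), upper half, heightwise — from a family of rows records -/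

/-- ★★★ **[Balaban1985UV3] THM 1 (5) UPPER, HEIGHTWISE — lit `Bounds5UpperAtHeight F γ E` VERBATIM — FOR THE PINNED `blockAvg ℰp` DENSITIES OF A FAMILY OF ROWS RECORDS**
(`E K :=` the record's start constant at `(γ, K)`), with the three per-height rows `hP` (46), `hE` (62)–(65), `hR` (remainder) DISPLAYED — ✓`bounds5UpperAtHeight_of_v3_rows`
VERBATIM over `q : ∀ K, PkgCoreRows F 𝔠 γ hγ hγ1 K`: (41)′ a.e. ✓`PkgCoreRows.resDensity_le_sum_ae`, the (41)_k large-field sum ✓`exists_lfSum_le_exp_ae_rows`, the counts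
✓`card_site_level_eq`∕✓`card_pBond_level_eq`, the measure-preserving `fieldShift`.  Constant of (5) at height `n`: `O1_n := a_n + b_n + c_n + 3A + 3∕(½ log L)`.
[cite: Balaban1985UV3, (5) p.256, Thm 1 p.257, (41) p.266, (46) p.267, (62) p.271, (64)–(65) p.273, Sect. D pp.272–274] -/
theorem bounds5UpperAtHeight_of_rows_displayed (q : ∀ K, AlphaInputsT3AC.PkgCoreRows F 𝔠 γ hγ hγ1 K)
    (hP : ∀ n : ℕ, ∃ a : ℝ, ∀ (K : ℕ) (hK : n ≤ K) (r : Hist (F.P K) (K - n))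
      (W : GaugeField (F.P K) (K - n) (Matrix.specialUnitaryGroup (Fin 2) ℂ)),
      |(q K).T.Pint (K - n) r W| ≤ a * ((F.P n).sitesPerDir 0 : ℝ) ^ 3)
    (hE : ∀ n : ℕ, ∃ b : ℝ, ∀ (K : ℕ) (hK : n ≤ K), |(q K).T.Ecst (K - n)| ≤ b * ((F.P n).sitesPerDir 0 : ℝ) ^ 3)
    (hR : ∀ n : ℕ, ∃ c : ℝ, ∀ (K : ℕ) (hK : n ≤ K), (q K).T.Rm (K - n) ≤ c * ((F.P n).sitesPerDir 0 : ℝ) ^ 3) :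
    Bounds5UpperAtHeight F γ (fun K => (q K).E) := by
  intro n
  obtain ⟨a, ha⟩ := hP n
  obtain ⟨b, hb⟩ := hE n
  obtain ⟨c, hcR⟩ := hR n
  obtain ⟨A, _, hlfF⟩ := exists_lfSum_le_exp_ae_rows F
  refine ⟨a + b + c + 3 * A + 3 / (Real.log F.L / 2), fun K hK => ?_⟩
  set p := q K with hp
  set N : ℝ := ((F.P n).sitesPerDir 0 : ℝ) with hN
  have hjK : K - n ≤ K := Nat.sub_le K n
  -- the two a.e. letters at level `j = K − n` of run `K`
  have hlf := hlfF 𝔠 γ hγ hγ1 K p (K - n) hjK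
  have hres := p.resDensity_le_sum_ae (K - n) hjK
  -- counts
  have hS : (Fintype.card (Site (F.P K) (K - n)) : ℝ) = N ^ 3 := card_site_level_eq F hK
  have hB : (Fintype.card (PBond (F.P K) (K - n)) : ℝ) = 3 * N ^ 3 := card_pBond_level_eq F hK
  -- the bound on the level-`(K − n)` lattice of run `K`, a.e.
  have hlev : ∀ᵐ W ∂fieldMeasure (F.P K) (K - n) (Matrix.specialUnitaryGroup (Fin 2) ℂ),
      Real.exp (-p.E) * resDensity F γ K Set.univ (K - n) W ≤ Real.exp ((a + b + c + 3 * A + 3 / (Real.log F.L / 2)) * N ^ 3) := by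
    filter_upwards [hlf, hres] with W hW hW41
    have hw0 : ∀ r : Hist (F.P K) (K - n), 0 ≤ p.wtP (K - n) r W := fun r =>
      (PinnedStep.wtP_nonneg_le 𝔠.lane p.X (AlphaInputsT3AC.admWindowT3 F 𝔠 γ hγ hγ1 K) (K - n) r W).1
    have hsum := sum_weight_pint_le (fun r => p.wtP (K - n) r W) (fun r => p.T.mainT (K - n) r W) (fun r => p.T.Pint (K - n) r W)
      (fun r => p.T.Zterm (K - n) r) (a * N ^ 3) hw0 (fun r => (abs_le.mp (ha K hK r W)).2)
    have hEb := (abs_le.mp (hb K hK)).1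
    have hRc := hcR K hK
    have hexp0 : 0 < Real.exp (-(p.T.Ecst (K - n) - p.E) + p.T.Rm (K - n)) := Real.exp_pos _
    -- `ρ ≤ exp(−(E_j − E) + Rm_j)·exp(aN³)·exp(3N³A)·exp((3∕ℓ)N³)`
    have h1 : resDensity F γ K Set.univ (K - n) W ≤
        Real.exp (-(p.T.Ecst (K - n) - p.E) + p.T.Rm (K - n)) *
          (Real.exp (a * N ^ 3) * Real.exp ((Fintype.card (PBond (F.P K) (K - n)) : ℝ) * A +
            3 / (Real.log F.L / 2) * (Fintype.card (Site (F.P K) (K - n)) : ℝ))) := by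
      refine hW41.trans (mul_le_mul_of_nonneg_left (hsum.trans ?_) hexp0.le)
      exact mul_le_mul_of_nonneg_left hW (Real.exp_pos _).le
    rw [hB, hS] at h1
    have h2 : Real.exp (-p.E) * resDensity F γ K Set.univ (K - n) W ≤
        Real.exp (-p.E) * (Real.exp (-(p.T.Ecst (K - n) - p.E) + p.T.Rm (K - n)) *
          (Real.exp (a * N ^ 3) * Real.exp (3 * N ^ 3 * A + 3 / (Real.log F.L / 2) * N ^ 3))) :=
      mul_le_mul_of_nonneg_left h1 (Real.exp_pos _).le
    refine h2.trans ?_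
    rw [← Real.exp_add, ← Real.exp_add, ← Real.exp_add]
    exact Real.exp_le_exp.mpr (by linarith [hEb, hRc])
  -- read on the `n`-th tower's finest lattice: `heightDensity = resDensity ∘ fieldShift`, `fieldShift` measure preserving
  have hmp := measurePreserving_fieldShift (G := Matrix.specialUnitaryGroup (Fin 2) ℂ)
    (F.sitesPerDir_eq (m := F.m) (K := K) (j := K - n) (m' := F.m) (K' := n) (j' := 0) (by omega))
  filter_upwards [hmp.quasiMeasurePreserving.ae hlev] with V hV
  exact hV

/-- ★★★★ **[Balaban1985UV3] THM 1 (5) UPPER, HEIGHTWISE — lit `Bounds5UpperAtHeight F γ E` VERBATIM — FROM A FAMILY OF ROWS RECORDS ALONE** (`q : ∀ K, PkgCoreRows F 𝔠 γ hγ hγ1 K`,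
`0 < γ ≤ (min γ₀ 1)²` inside `q`'s type; `E K :=` the record's start constant of run `K`): for every height `n` ONE `O1_n` with `e^{−E_K}·heightDensity F γ hK univ V ≤ exp(O1_n·N_n³)`
for `dU_n`-almost every `V` and EVERY `K ≥ n` — §4's displayed form with §1 (`Rm`), §2 ((46)) and §3 ((62)–(65)).  NO other hypothesis; every socket version feeds it (§5).
[cite: Balaban1985UV3, (5) p.256, Thm 1 p.257, (41) p.266, (46) p.267, (62) p.271, (64)–(65) p.273, Sect. D pp.272–274] -/
theorem bounds5UpperAtHeight_of_rows (q : ∀ K, AlphaInputsT3AC.PkgCoreRows F 𝔠 γ hγ hγ1 K) :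
    Bounds5UpperAtHeight F γ (fun K => (q K).E) :=
  bounds5UpperAtHeight_of_rows_displayed q
    (fun _ => ⟨_, fun K hK r W => abs_Pint_le_height_rows (q K) hK r W⟩)
    (fun _ => ⟨_, fun K hK => abs_Ecst_le_height_rows (q K) hK⟩)
    (fun n => ⟨_, fun K _ => Rm_height_le_rows (q K) n⟩)

/-! ## §5 The socket reading: the v4 χ-socket (the currency the suppliers of record deliver)

The v3 edition is recovered LETTER FOR LETTER: for `h : AlphaInputsT3AC.OfV3At F 𝔠 a₀ a₁`, `bounds5UpperAtHeight_of_rows fun K => (h.pkgAtV3 hc γ hγ hγ1 K).toCore.toRows`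
has the type of ✓`UV3ACBounds5UpperRows.bounds5UpperAtHeight_of_v3 h hc γ hγ hγ1` (`(p.toCore.toRows).E` is `p.E` by `rfl`; the gate's dedup confirms it; not re-declared). -/

/-- ★★★★ **THM 1 (5) UPPER, HEIGHTWISE, FROM THE v4 χ-SOCKET ALONE**: for `h : AlphaInputsT3AC.OfV4ChiAt F 𝔠 a₀ a₁` (the (α) socket the 19936 registry's stubs {EX, (O‴χₛ)} deliver,
✓`laneRecordsV4Chi_of_thm1In8_selXsDataRows_allL`; OPEN) and `0 < γ ≤ (min γ₀ 1)²`, with `E K :=` the chosen v4 χ-package's start constant of run `K`: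
`Bounds5UpperAtHeight F γ E` (§4 at the projected rows records `(h.pkgAtV4Chi hc γ hγ hγ1 K).toRows`). [cite: Balaban1985UV3, (5) p.256, Thm 1 p.257, (41) p.266, (71) p.273, Sect. D pp.272–274] -/
theorem bounds5UpperAtHeight_of_v4Chi {a₀ a₁ : ℝ} (h : AlphaInputsT3AC.OfV4ChiAt F 𝔠 a₀ a₁) (hc : 0 < a₀ ∧ 0 < a₁ ∧ 𝔠.B₃ * a₁ ≤ a₀)
    (γ : ℝ) (hγ : 0 < γ) (hγ1 : γ ≤ (min 𝔠.gamma0 1) ^ 2) :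
    Bounds5UpperAtHeight F γ (fun K => (h.pkgAtV4Chi hc γ hγ hγ1 K).toRows.E) :=
  bounds5UpperAtHeight_of_rows fun K => (h.pkgAtV4Chi hc γ hγ hγ1 K).toRows

end Summit.QuantumFields.YangMills.Theorems.UV3ACBounds5UpperOfRows

end
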